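import Literature.NumberTheory.GaloisRepresentations.CubicEisensteinRamificationTotallyRamifiedProofs
import Mathlib.AlgebraicGeometry.EllipticCurve.VariableChange
import Mathlib.RingTheory.DedekindDomain.AdicValuation
import HarnessLib

/-!
# Eisenstein data for the `2`-division cubic from the `v`-adic shapes of `b₂, b₄, b₆, Δ`
# (Ogg's formula at `p = 3`, wild Kodaira types; Silverman *ATAEC* IV.11.1)

`Proofs` file (theorems only, no definitions, no named facts), landed by the seat of bsd.S15
(`Literature.NumberTheory.EllipticCurves.conductorNorm_eq_artinConductorNat_of_isElliptic`) as the
arithmetic glue between the discriminant side of Ogg's formula for the wild Kodaira types at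
`p = 3` (`OggFormulaWildTypesKodairaProofs`, `VariableChangeApproxProofs`: a Weierstrass equation
over the number field `K` with `ord_v(b₂) ≥ k₂`, `ord_v(b₄) ≥ k₄`, `ord_v(b₆) = k₆`,
`ord_v(Δ) = e`) and the Galois side (`OggWildThreeLinearProofs`, `OggWildThreeQuadraticProofs`,
which want a scaling `λ ∈ Kˣ` making the cubic of the `λeᵢ`, resp. `λeᵢ²`, **integral over `𝓞 K`
and Eisenstein at `v`**):

* `OggWild.exists_scaling` — `λ ∈ Kˣ` with `ord_v λ = -c` and `|λ|_q ≤ |16d²|_q` at all `q ≠ v`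
  (`λ = y/πᶜ`, `y ∉ v` in the prime-to-`v` part of `(16d²πᶜ)`;
  `exists_notMem_forall_mul_mem_span`, `intValuation_le_of_forall_mul_mem_span`);
* `OggWild.exists_eisenstein_data_linear` — types `II` (`(k₂,k₄,k₆) = (1,1,1)`, `c = 0`) and
  `IV*` (`(2,3,4)`, `c = 1`): `c₂ = λb₂/4`, `c₁ = λ²b₄/2`, `c₀ = λ³b₆/4 ∈ 𝓞 K`, Eisenstein at
  `v`, `ord_v(disc) = e - 6c` (`16·disc = λ⁶Δ`);
* `OggWild.exists_eisenstein_data_quadratic` — types `IV` (`(1,2,2)`, `c = 1`) and `II*`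
  (`(2,4,5)`, `c = 3`): `c₂ = -λ(b₂² - 16b₄)/16`, `c₁ = λ²(2b₄² - b₂b₆)/8`, `c₀ = -λ³b₆²/16`,
  Eisenstein at `v`, `ord_v(disc) = e + 2k₆ - 6c` (`1024·disc = λ⁶Δ(2b₆ - b₂b₄)²`).

Integrality is checked place by place (`HeightOneSpectrum.mem_integers_of_valuation_le_one`) with
a common denominator `d` of `b₂, b₄, b₆`; the `v`-adic bookkeeping is Silverman's table
(*ATAEC* p. 368) and pp. 369–371.  Also `ord_eq_natCast_iff_intValuation_eq` (the tree's `ord`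
versus Mathlib's `intValuation`).

No definitions, no named facts.  All axioms `propext`, `Classical.choice`, `Quot.sound`.

## References

* J. H. Silverman, *Advanced Topics in the Arithmetic of Elliptic Curves*, GTM 151 (1994), proof of
  Thm. IV.11.1 for `p = 3` (PDF pp. 366–371). [SilvermanATAEC1994]
-/

noncomputable section

open scoped Classical
open IsDedekindDomain WithZero Literature.NumberTheory.GaloisRepresentations

namespace WeierstrassCurve

namespace OggWild

variable {R : Type*} [CommRing R] [IsDedekindDomain R] {K : Type*} [Field K] [Algebra R K]
  [IsFractionRing R K]

/-! ### Valuation helpers -/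

/-- Cancellation in `ℤᵐ⁰`: `a c ≤ b c`, `c ≠ 0` gives `a ≤ b`. [folklore] -/
theorem le_of_mul_le_mul_right₀' {a b c : ℤᵐ⁰} (hc : c ≠ 0) (h : a * c ≤ b * c) : a ≤ b := by
  have := mul_le_mul_left h c⁻¹
  rwa [mul_assoc, mul_assoc, mul_inv_cancel₀ hc, mul_one, mul_one] at this

/-- **The prime-to-`v` part of a principal ideal**: for `D ≠ 0` in a Dedekind domain and a
non-zero prime `v` there are `t ∉ v` and `a` with `t · vᵃ ⊆ (D)` (`(D) = vᵃ 𝔞`, `v ∤ 𝔞`,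
`t ∈ 𝔞 ∖ v`). [folklore] -/
theorem exists_notMem_forall_mul_mem_span (v : HeightOneSpectrum R) {D : R} (hD : D ≠ 0) :
    ∃ (t : R) (a : ℕ), t ∉ v.asIdeal ∧ ∀ z ∈ v.asIdeal ^ a, t * z ∈ Ideal.span {D} := by
  have hfin : FiniteMultiplicity v.asIdeal (Ideal.span {D}) := by
    rw [finiteMultiplicity_iff_emultiplicity_ne_top]
    change ord v.asIdeal D ≠ ⊤
    haveI := v.isPrime
    exact ord_ne_top v.asIdeal v.ne_bot hD
  obtain ⟨𝔞, h𝔞, hndvd⟩ := hfin.exists_eq_pow_mul_and_not_dvd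
  have hle : ¬ 𝔞 ≤ v.asIdeal := fun h ↦ hndvd (Ideal.dvd_iff_le.mpr h)
  obtain ⟨t, ht𝔞, htv⟩ := Set.not_subset.mp hle
  refine ⟨t, multiplicity v.asIdeal (Ideal.span {D}), htv, fun z hz ↦ ?_⟩
  rw [h𝔞, mul_comm (v.asIdeal ^ _) 𝔞]
  exact Ideal.mul_mem_mul ht𝔞 hz

/-- The valuation consequence at the other primes: if `t · vᵃ ⊆ (D)` then `|t|_q ≤ |D|_q` for
every `q ≠ v` (take `z ∈ vᵃ ∖ q`). [folklore] -/
theorem intValuation_le_of_forall_mul_mem_span (v : HeightOneSpectrum R) {D t : R} {a : ℕ}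
    (ht : ∀ z ∈ v.asIdeal ^ a, t * z ∈ Ideal.span {D}) {q : HeightOneSpectrum R} (hq : q ≠ v) :
    q.intValuation t ≤ q.intValuation D := by
  -- `vᵃ ⊄ q`
  have hnot : ¬ v.asIdeal ^ a ≤ q.asIdeal := by
    intro h
    haveI := q.isPrime
    have h1 : v.asIdeal ≤ q.asIdeal := Ideal.IsPrime.le_of_pow_le h
    exact hq (HeightOneSpectrum.ext (v.isMaximal.eq_of_le q.isPrime.ne_top h1).symm)
  obtain ⟨z, hz, hzq⟩ := Set.not_subset.mp hnot
  obtain ⟨m, hm⟩ := Ideal.mem_span_singleton'.mp (ht z hz)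
  have hzval : q.intValuation z = 1 := HeightOneSpectrum.intValuation_eq_one_iff.mpr hzq
  calc q.intValuation t = q.intValuation t * q.intValuation z := by rw [hzval, mul_one]
    _ = q.intValuation (m * D) := by rw [← map_mul, hm]
    _ = q.intValuation m * q.intValuation D := map_mul _ _ _
    _ ≤ 1 * q.intValuation D := mul_le_mul_left (q.intValuation_le_one m) _
    _ = q.intValuation D := one_mul _

/-- `v_𝔭(x) = n ↔ |x|_v = exp(-n)` for `x ∈ R` (`ord` is the multiplicity of `v` in `(x)`).
[folklore] -/
theorem ord_eq_natCast_iff_intValuation_eq (v : HeightOneSpectrum R) (x : R) (n : ℕ) :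
    ord v.asIdeal x = n ↔ v.intValuation x = exp (-(n : ℤ)) := by
  have key : ∀ m : ℕ, v.intValuation x ≤ exp (-(m : ℤ)) ↔ (m : ℕ∞) ≤ ord v.asIdeal x :=
    fun m ↦ v.intValuation_le_exp_iff_le_emultiplicity
  constructor
  · intro h
    refine le_antisymm ((key n).mpr h.ge) ?_
    by_contra hlt
    push Not at hlt
    -- `|x| < exp(-n)` means `|x| ≤ exp(-(n+1))`
    have hle : v.intValuation x ≤ exp (-((n + 1 : ℕ) : ℤ)) := by
      by_cases hx : x = 0
      · simp [hx]
      · have hne := v.intValuation_ne_zero x hx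
        rw [← exp_log hne] at hlt ⊢
        rw [exp_lt_exp] at hlt
        rw [exp_le_exp]
        push_cast
        omega
    have := (key (n + 1)).mp hle
    rw [h] at this
    exact absurd (by exact_mod_cast this : n + 1 ≤ n) (by omega)
  · intro h
    refine le_antisymm ?_ ((key n).mp h.le)
    by_contra hlt
    push Not at hlt
    have hle : ((n + 1 : ℕ) : ℕ∞) ≤ ord v.asIdeal x := Order.add_one_le_of_lt hlt
    have := (key (n + 1)).mpr hle
    rw [h, exp_le_exp] at this
    push_cast at this
    omega

/-- An element of `K` with all valuations `≤ 1` is in `R`. [folklore] -/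
theorem exists_algebraMap_eq_of_valuation_le_one {x : K}
    (h : ∀ q : HeightOneSpectrum R, q.valuation K x ≤ 1) : ∃ y : R, algebraMap R K y = x := by
  obtain ⟨y, hy⟩ := HeightOneSpectrum.mem_integers_of_valuation_le_one (R := R) K x h
  exact ⟨y, hy⟩


/-! ### The scaling factor `λ` -/

section NumberField

open scoped NumberField

variable {K : Type*} [Field K] [NumberField K]

/-- **The scaling factor.**  For a finite place `v`, `c : ℕ` and a non-zero `d ∈ 𝓞 K` there is
`λ ∈ Kˣ` with `|λ|_v = exp(c)` (i.e. `ord_v λ = -c`) and `|λ|_q ≤ |16 d²|_q` at every other finite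
place `q` (`λ = y/πᶜ` with `π` a uniformiser at `v` and `y ∉ v` in the prime-to-`v` part of
`(16 d² πᶜ)`). [folklore] -/
theorem exists_scaling (v : HeightOneSpectrum (𝓞 K)) (c : ℕ) {d : 𝓞 K} (hd : d ≠ 0) :
    ∃ lam : K, lam ≠ 0 ∧ v.valuation K lam = exp (c : ℤ) ∧
      ∀ q : HeightOneSpectrum (𝓞 K), q ≠ v →
        q.valuation K lam ≤ q.valuation K (algebraMap (𝓞 K) K (16 * d ^ 2)) := by
  haveI := v.isPrime
  obtain ⟨π, hπ, hπ2⟩ := Ideal.exists_mem_pow_notMem_pow_succ v.asIdeal v.ne_bot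
    v.isPrime.ne_top 1
  rw [pow_one] at hπ
  have hπ0 : π ≠ 0 := by rintro rfl; exact hπ2 (zero_mem _)
  have h16 : (16 : 𝓞 K) ≠ 0 := by norm_num
  set D : 𝓞 K := 16 * d ^ 2 * π ^ c with hD
  have hD0 : D ≠ 0 := mul_ne_zero (mul_ne_zero h16 (pow_ne_zero _ hd)) (pow_ne_zero _ hπ0)
  obtain ⟨y, a, hyv, hy⟩ := exists_notMem_forall_mul_mem_span v hD0
  have hy0 : y ≠ 0 := by rintro rfl; exact hyv (zero_mem _)
  have hπval : v.valuation K (algebraMap (𝓞 K) K π) = exp (-1 : ℤ) := by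
    rw [HeightOneSpectrum.valuation_of_algebraMap]
    have := (ord_eq_natCast_iff_intValuation_eq v π 1).mp (ord_eq_one _ hπ hπ2)
    exact_mod_cast this
  refine ⟨algebraMap (𝓞 K) K y / algebraMap (𝓞 K) K π ^ c, ?_, ?_, ?_⟩
  · exact div_ne_zero ((map_ne_zero_iff _ (IsFractionRing.injective (𝓞 K) K)).mpr hy0)
      (pow_ne_zero _ ((map_ne_zero_iff _ (IsFractionRing.injective (𝓞 K) K)).mpr hπ0))
  · rw [map_div₀, map_pow, hπval, (v.valuation_eq_one_iff_notMem (K := K)).mpr hyv, one_div,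
      ← exp_nsmul, ← exp_neg]
    congr 1; simp
  · intro q hq
    have hyq : q.intValuation y ≤ q.intValuation D := intValuation_le_of_forall_mul_mem_span v hy hq
    have hπq0 : q.valuation K (algebraMap (𝓞 K) K π ^ c) ≠ 0 :=
      (map_ne_zero _).mpr (pow_ne_zero _ ((map_ne_zero_iff _ (IsFractionRing.injective (𝓞 K) K)).mpr hπ0))
    have hπK0 : algebraMap (𝓞 K) K π ^ c ≠ 0 :=
      pow_ne_zero _ ((map_ne_zero_iff _ (IsFractionRing.injective (𝓞 K) K)).mpr hπ0)
    apply le_of_mul_le_mul_right₀' hπq0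
    rw [← map_mul, ← map_mul, div_mul_cancel₀ _ hπK0, ← map_pow, ← map_mul,
      HeightOneSpectrum.valuation_of_algebraMap, HeightOneSpectrum.valuation_of_algebraMap, ← hD]
    exact hyq

/-- `|n|_v = 1` for a natural number `n` prime to `v` … here for powers of `2` at `v ∤ 2`.
[folklore] -/
theorem valuation_two_pow_eq_one (v : HeightOneSpectrum (𝓞 K)) (h2 : (2 : 𝓞 K) ∉ v.asIdeal)
    (k : ℕ) : v.valuation K ((2 : K) ^ k) = 1 := by
  have : v.valuation K (2 : K) = 1 := by
    rw [show (2 : K) = algebraMap (𝓞 K) K 2 from (map_ofNat _ 2).symm,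
      v.valuation_eq_one_iff_notMem (K := K)]
    exact h2
  rw [map_pow, this, one_pow]

/-- `|n|_q ≤ 1` for every natural number. [folklore] -/
theorem valuation_natCast_le_one (q : HeightOneSpectrum (𝓞 K)) (n : ℕ) :
    q.valuation K (n : K) ≤ 1 := by
  rw [show (n : K) = algebraMap (𝓞 K) K n from (map_natCast _ n).symm]
  exact q.valuation_le_one _

/-- A common denominator of three elements of `K`. [folklore] -/
theorem exists_common_denominator (x y z : K) :
    ∃ (d : 𝓞 K) (mx my mz : 𝓞 K), d ≠ 0 ∧ algebraMap (𝓞 K) K mx = algebraMap (𝓞 K) K d * x ∧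
      algebraMap (𝓞 K) K my = algebraMap (𝓞 K) K d * y ∧
      algebraMap (𝓞 K) K mz = algebraMap (𝓞 K) K d * z := by
  obtain ⟨nx, dx, hdx, hx⟩ := IsFractionRing.div_surjective (A := 𝓞 K) x
  obtain ⟨ny, dy, hdy, hy⟩ := IsFractionRing.div_surjective (A := 𝓞 K) y
  obtain ⟨nz, dz, hdz, hz⟩ := IsFractionRing.div_surjective (A := 𝓞 K) z
  have hdx0 : dx ≠ 0 := nonZeroDivisors.ne_zero hdx
  have hdy0 : dy ≠ 0 := nonZeroDivisors.ne_zero hdy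
  have hdz0 : dz ≠ 0 := nonZeroDivisors.ne_zero hdz
  have ι0 : ∀ {t : 𝓞 K}, t ≠ 0 → algebraMap (𝓞 K) K t ≠ 0 :=
    fun ht ↦ (map_ne_zero_iff _ (IsFractionRing.injective (𝓞 K) K)).mpr ht
  refine ⟨dx * dy * dz, nx * dy * dz, dx * ny * dz, dx * dy * nz,
    mul_ne_zero (mul_ne_zero hdx0 hdy0) hdz0, ?_, ?_, ?_⟩
  · rw [← hx]; simp only [map_mul]; field_simp [ι0 hdx0]
  · rw [← hy]; simp only [map_mul]; field_simp [ι0 hdy0]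
  · rw [← hz]; simp only [map_mul]; field_simp [ι0 hdz0]

/-- Integrality test used below: `x ∈ 𝓞 K` as soon as `|x|_v ≤ 1` and, at every `q ≠ v`,
`|x · N|_q ≤ |N|_q` for some `N ≠ 0`. [folklore] -/
theorem exists_algebraMap_eq_of_valuation_le (v : HeightOneSpectrum (𝓞 K)) {x N : K} (hN : N ≠ 0)
    (hv : v.valuation K x ≤ 1)
    (hq : ∀ q : HeightOneSpectrum (𝓞 K), q ≠ v → q.valuation K (x * N) ≤ q.valuation K N) :
    ∃ y : 𝓞 K, algebraMap (𝓞 K) K y = x := by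
  refine exists_algebraMap_eq_of_valuation_le_one fun q ↦ ?_
  by_cases hqv : q = v
  · rw [hqv]; exact hv
  · have h := hq q hqv
    rw [map_mul] at h
    have hN' : q.valuation K N ≠ 0 := (map_ne_zero _).mpr hN
    exact le_of_mul_le_mul_right₀' hN' (by rwa [one_mul])

/-! ### Eisenstein data, linear case (`θ = λe`: Kodaira types `II`, `IV*`) -/

/-- **Eisenstein data for `θ = λe`.**  Let `Y/K` be a Weierstrass equation, `v ∤ 2` a finite
place, and suppose `ord_v(b₂) ≥ k₂`, `ord_v(b₄) ≥ k₄`, `ord_v(b₆) = k₆`, `ord_v(Δ) = e` with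
`(k₂, k₄, k₆) = (1, 1, 1)` and `c = 0` (type `II`) or `(2, 3, 4)` and `c = 1` (type `IV*`).  Then
for `λ` as in `exists_scaling` (`ord_v λ = -c`, `|λ|_q ≤ |16d²|_q` elsewhere, `d` a common
denominator of `b₂, b₄, b₆`) the numbers `c₂ = λb₂/4`, `c₁ = λ²b₄/2`, `c₀ = λ³b₆/4` lie in
`𝓞 K`, the cubic `X³ + c₂X² + c₁X + c₀` is **Eisenstein at `v`** (`ord_v c₂ = ord b₂ - c ≥ 1`,
`ord_v c₁ = ord b₄ - 2c ≥ 1`, `ord_v c₀ = k₆ - 3c = 1`), and its discriminant has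
`ord_v = e - 6c` (`16·disc = λ⁶Δ`).  Silverman *ATAEC* p. 368 (table: types `II`, `IV*`) and
p. 371. [cite: SilvermanATAEC1994, proof of Thm. IV.11.1 for p = 3 (PDF pp. 368, 371)] -/
theorem exists_eisenstein_data_linear (Y : WeierstrassCurve K) (v : HeightOneSpectrum (𝓞 K))
    (h2 : (2 : 𝓞 K) ∉ v.asIdeal) {c k₂ k₄ k₆ e : ℕ}
    (hk : (c = 0 ∧ k₂ = 1 ∧ k₄ = 1 ∧ k₆ = 1) ∨ (c = 1 ∧ k₂ = 2 ∧ k₄ = 3 ∧ k₆ = 4))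
    (hb₂ : v.valuation K Y.b₂ ≤ exp (-(k₂ : ℤ))) (hb₄ : v.valuation K Y.b₄ ≤ exp (-(k₄ : ℤ)))
    (hb₆ : v.valuation K Y.b₆ = exp (-(k₆ : ℤ))) (hΔ : v.valuation K Y.Δ = exp (-(e : ℤ))) :
    ∃ (lam : K) (c₂ c₁ c₀ : 𝓞 K) (n : ℕ), lam ≠ 0 ∧
      (c₂ : K) * 4 = lam * Y.b₂ ∧ (c₁ : K) * 2 = lam ^ 2 * Y.b₄ ∧ (c₀ : K) * 4 = lam ^ 3 * Y.b₆ ∧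
      c₂ ∈ v.asIdeal ∧ c₁ ∈ v.asIdeal ∧ c₀ ∈ v.asIdeal ∧ c₀ ∉ v.asIdeal ^ 2 ∧
      ord v.asIdeal (c₂ ^ 2 * c₁ ^ 2 - 4 * c₁ ^ 3 - 4 * c₂ ^ 3 * c₀ - 27 * c₀ ^ 2 +
        18 * c₂ * c₁ * c₀) = n ∧ n + 6 * c = e := by
  set ι := algebraMap (𝓞 K) K with hι
  have ιinj : Function.Injective ι := IsFractionRing.injective (𝓞 K) K
  -- a common denominator `d` of `b₂, b₄, b₆` and the scaling factor `λ`
  obtain ⟨d, m₂, m₄, m₆, hd, hm₂, hm₄, hm₆⟩ := exists_common_denominator Y.b₂ Y.b₄ Y.b₆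
  obtain ⟨lam, hlam0, hlamv, hlamq⟩ := exists_scaling v c hd
  have hdK : ι d ≠ 0 := (map_ne_zero_iff _ ιinj).mpr hd
  -- valuations of numerals
  have hv2 : ∀ k : ℕ, v.valuation K ((2 : K) ^ k) = 1 := valuation_two_pow_eq_one v h2
  have hv4 : v.valuation K (4 : K) = 1 := by have h := hv2 2; norm_num at h; exact h
  have hv2' : v.valuation K (2 : K) = 1 := by have h := hv2 1; norm_num at h; exact h
  have hv16 : v.valuation K (16 : K) = 1 := by have h := hv2 4; norm_num at h; exact h
  have hq16 : ∀ q : HeightOneSpectrum (𝓞 K), q.valuation K (16 : K) ≤ q.valuation K (4 : K) ∧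
      q.valuation K (16 : K) ^ 2 ≤ q.valuation K (2 : K) ∧
      q.valuation K (16 : K) ^ 3 ≤ q.valuation K (4 : K) := by
    intro q
    have h4 : q.valuation K (4 : K) ≤ 1 := by exact_mod_cast valuation_natCast_le_one q 4
    have h16 : q.valuation K (16 : K) ≤ 1 := by exact_mod_cast valuation_natCast_le_one q 16
    have h128 : q.valuation K (128 : K) ≤ 1 := by exact_mod_cast valuation_natCast_le_one q 128
    have h1024 : q.valuation K (1024 : K) ≤ 1 := by exact_mod_cast valuation_natCast_le_one q 1024
    refine ⟨?_, ?_, ?_⟩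
    · rw [show (16 : K) = 4 * 4 by norm_num, map_mul]
      exact mul_le_of_le_one_left' h4
    · rw [← map_pow, show (16 : K) ^ 2 = 128 * 2 by norm_num, map_mul]
      exact mul_le_of_le_one_left' h128
    · rw [← map_pow, show (16 : K) ^ 3 = 1024 * 4 by norm_num, map_mul]
      exact mul_le_of_le_one_left' h1024
  -- valuations of `d bⱼ` and of `λ` at `q ≠ v`
  have hdb : ∀ q : HeightOneSpectrum (𝓞 K), q.valuation K (ι d * Y.b₂) ≤ 1 ∧
      q.valuation K (ι d * Y.b₄) ≤ 1 ∧ q.valuation K (ι d * Y.b₆) ≤ 1 := fun q ↦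
    ⟨hm₂ ▸ q.valuation_le_one _, hm₄ ▸ q.valuation_le_one _, hm₆ ▸ q.valuation_le_one _⟩
  have hdq : ∀ q : HeightOneSpectrum (𝓞 K), q.valuation K (ι d) ≤ 1 := fun q ↦ q.valuation_le_one _
  have hlamq' : ∀ q : HeightOneSpectrum (𝓞 K), q ≠ v →
      q.valuation K lam ≤ q.valuation K (16 : K) * q.valuation K (ι d) ^ 2 := by
    intro q hq
    have := hlamq q hq
    rwa [map_mul, map_pow, map_ofNat, map_mul, map_pow] at this
  -- the three coefficients as elements of `K`
  set C₂ : K := lam * Y.b₂ / 4 with hC₂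
  set C₁ : K := lam ^ 2 * Y.b₄ / 2 with hC₁
  set C₀ : K := lam ^ 3 * Y.b₆ / 4 with hC₀
  have h4K : (4 : K) ≠ 0 := by norm_num
  have h2K : (2 : K) ≠ 0 := by norm_num
  have eC₂ : C₂ * 4 = lam * Y.b₂ := by rw [hC₂]; field_simp
  have eC₁ : C₁ * 2 = lam ^ 2 * Y.b₄ := by rw [hC₁]; field_simp
  have eC₀ : C₀ * 4 = lam ^ 3 * Y.b₆ := by rw [hC₀]; field_simp
  -- the numerology of the two types
  have hkc : c + 1 ≤ k₂ ∧ 2 * c + 1 ≤ k₄ ∧ k₆ = 3 * c + 1 := by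
    rcases hk with ⟨h1, h2, h3, h4⟩ | ⟨h1, h2, h3, h4⟩ <;> omega
  obtain ⟨hk₂, hk₄, hk₆⟩ := hkc
  have hexp : ∀ (k : ℕ) (b : ℤ), exp b ^ k = exp ((k : ℤ) * b) := fun k b ↦ by
    rw [← exp_nsmul]; simp
  -- their `v`-adic valuations
  have vC₂ : v.valuation K C₂ ≤ exp (-1 : ℤ) := by
    have h : v.valuation K C₂ * v.valuation K (4 : K) = v.valuation K lam * v.valuation K Y.b₂ := by
      rw [← map_mul, ← map_mul, eC₂]
    rw [hv4, mul_one, hlamv] at h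
    rw [h]
    calc exp (c : ℤ) * v.valuation K Y.b₂ ≤ exp (c : ℤ) * exp (-(k₂ : ℤ)) := mul_le_mul_right hb₂ _
      _ ≤ exp (-1) := by rw [← exp_add, exp_le_exp]; omega
  have vC₁ : v.valuation K C₁ ≤ exp (-1 : ℤ) := by
    have h : v.valuation K C₁ * v.valuation K (2 : K) =
        v.valuation K lam ^ 2 * v.valuation K Y.b₄ := by
      rw [← map_pow, ← map_mul, ← map_mul, eC₁]
    rw [hv2', mul_one, hlamv, hexp] at h
    rw [h]
    calc exp ((2 : ℕ) * (c : ℤ)) * v.valuation K Y.b₄ ≤ exp ((2 : ℕ) * (c : ℤ)) * exp (-(k₄ : ℤ)) :=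
          mul_le_mul_right hb₄ _
      _ ≤ exp (-1) := by rw [← exp_add, exp_le_exp]; push_cast; omega
  have vC₀ : v.valuation K C₀ = exp (-1 : ℤ) := by
    have h : v.valuation K C₀ * v.valuation K (4 : K) =
        v.valuation K lam ^ 3 * v.valuation K Y.b₆ := by
      rw [← map_pow, ← map_mul, ← map_mul, eC₀]
    rw [hv4, mul_one, hlamv, hexp, hb₆, ← exp_add] at h
    rw [h]; congr 1; push_cast; omega
  -- integrality
  have hle1 : exp (-1 : ℤ) ≤ (1 : ℤᵐ⁰) := by rw [← exp_zero, exp_le_exp]; norm_num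
  have hpow4 : ∀ y : ℤᵐ⁰, (y ^ 2) ^ 2 = y ^ 3 * y := fun y ↦ by rw [← pow_mul]; exact pow_succ y 3
  have hpow6 : ∀ y : ℤᵐ⁰, (y ^ 2) ^ 3 = y ^ 5 * y := fun y ↦ by rw [← pow_mul]; exact pow_succ y 5
  obtain ⟨c₂, hc₂⟩ : ∃ y : 𝓞 K, ι y = C₂ := by
    refine exists_algebraMap_eq_of_valuation_le v h4K (vC₂.trans hle1) fun q hq ↦ ?_
    rw [eC₂, map_mul]
    calc q.valuation K lam * q.valuation K Y.b₂
        ≤ (q.valuation K (16 : K) * q.valuation K (ι d) ^ 2) * q.valuation K Y.b₂ :=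
          mul_le_mul_left (hlamq' q hq) _
      _ = q.valuation K (16 : K) * q.valuation K (ι d) * q.valuation K (ι d * Y.b₂) := by
          rw [map_mul, pow_two]; simp only [mul_assoc]
      _ ≤ q.valuation K (16 : K) * 1 * 1 :=
          mul_le_mul' (mul_le_mul_right (hdq q) _) (hdb q).1
      _ ≤ q.valuation K (4 : K) := by rw [mul_one, mul_one]; exact (hq16 q).1
  obtain ⟨c₁, hc₁⟩ : ∃ y : 𝓞 K, ι y = C₁ := by
    refine exists_algebraMap_eq_of_valuation_le v h2K (vC₁.trans hle1) fun q hq ↦ ?_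
    rw [eC₁, map_mul, map_pow]
    calc q.valuation K lam ^ 2 * q.valuation K Y.b₄
        ≤ (q.valuation K (16 : K) * q.valuation K (ι d) ^ 2) ^ 2 * q.valuation K Y.b₄ :=
          mul_le_mul_left (pow_le_pow_left' (hlamq' q hq) 2) _
      _ = q.valuation K (16 : K) ^ 2 * q.valuation K (ι d) ^ 3 * (q.valuation K (ι d) * q.valuation K Y.b₄) := by
          rw [mul_pow, hpow4]; simp only [mul_assoc]
      _ = q.valuation K (16 : K) ^ 2 * q.valuation K (ι d) ^ 3 * q.valuation K (ι d * Y.b₄) := by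
          rw [map_mul]
      _ ≤ q.valuation K (16 : K) ^ 2 * 1 * 1 :=
          mul_le_mul' (mul_le_mul_right (pow_le_one' (hdq q) 3) _) (hdb q).2.1
      _ ≤ q.valuation K (2 : K) := by rw [mul_one, mul_one]; exact (hq16 q).2.1
  obtain ⟨c₀, hc₀⟩ : ∃ y : 𝓞 K, ι y = C₀ := by
    refine exists_algebraMap_eq_of_valuation_le v h4K (vC₀.le.trans hle1) fun q hq ↦ ?_
    rw [eC₀, map_mul, map_pow]
    calc q.valuation K lam ^ 3 * q.valuation K Y.b₆
        ≤ (q.valuation K (16 : K) * q.valuation K (ι d) ^ 2) ^ 3 * q.valuation K Y.b₆ :=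
          mul_le_mul_left (pow_le_pow_left' (hlamq' q hq) 3) _
      _ = q.valuation K (16 : K) ^ 3 * q.valuation K (ι d) ^ 5 * (q.valuation K (ι d) * q.valuation K Y.b₆) := by
          rw [mul_pow, hpow6]; simp only [mul_assoc]
      _ = q.valuation K (16 : K) ^ 3 * q.valuation K (ι d) ^ 5 * q.valuation K (ι d * Y.b₆) := by
          rw [map_mul]
      _ ≤ q.valuation K (16 : K) ^ 3 * 1 * 1 :=
          mul_le_mul' (mul_le_mul_right (pow_le_one' (hdq q) 5) _) (hdb q).2.2
      _ ≤ q.valuation K (4 : K) := by rw [mul_one, mul_one]; exact (hq16 q).2.2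
  -- membership in `v`, `v²`
  have mem_of_le : ∀ {y : 𝓞 K}, v.valuation K (ι y) ≤ exp (-1 : ℤ) → y ∈ v.asIdeal := by
    intro y hy
    apply (v.valuation_lt_one_iff_mem (K := K) y).mp
    exact lt_of_le_of_lt hy (by rw [← exp_zero, exp_lt_exp]; norm_num)
  have hc₂v : c₂ ∈ v.asIdeal := mem_of_le (by rw [hc₂]; exact vC₂)
  have hc₁v : c₁ ∈ v.asIdeal := mem_of_le (by rw [hc₁]; exact vC₁)
  have hc₀v : c₀ ∈ v.asIdeal := mem_of_le (by rw [hc₀]; exact vC₀.le)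
  have hc₀v' : c₀ ∉ v.asIdeal ^ 2 := by
    intro h
    have := (v.intValuation_le_pow_iff_mem c₀ 2).mpr h
    rw [← HeightOneSpectrum.valuation_of_algebraMap (K := K)] at this
    change v.valuation K (ι c₀) ≤ _ at this
    rw [hc₀, vC₀, exp_le_exp] at this
    norm_num at this
  -- the discriminant: `16 · disc = λ⁶ Δ`
  set D : 𝓞 K := c₂ ^ 2 * c₁ ^ 2 - 4 * c₁ ^ 3 - 4 * c₂ ^ 3 * c₀ - 27 * c₀ ^ 2 +
    18 * c₂ * c₁ * c₀ with hDdef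
  have hDK : ι D * 16 = lam ^ 6 * Y.Δ := by
    have hrel := Y.b_relation
    simp only [hDdef, map_add, map_sub, map_mul, map_pow, map_ofNat, hc₂, hc₁, hc₀, hC₂, hC₁, hC₀,
      WeierstrassCurve.Δ]
    linear_combination (lam ^ 6 * Y.b₂ ^ 2 / 4) * hrel
  have vD : v.valuation K (ι D) = exp (6 * (c : ℤ) - e) := by
    have h : v.valuation K (ι D) * v.valuation K (16 : K) = v.valuation K lam ^ 6 * v.valuation K Y.Δ := by
      rw [← map_pow, ← map_mul, ← map_mul, hDK]
    rw [hv16, mul_one, hlamv, hΔ, hexp, ← exp_add] at h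
    rw [h]; congr 1
  have h6c : 6 * c ≤ e := by
    have h := v.valuation_le_one (K := K) D
    change v.valuation K (ι D) ≤ 1 at h
    rw [vD, ← exp_zero, exp_le_exp] at h
    omega
  refine ⟨lam, c₂, c₁, c₀, e - 6 * c, hlam0, ?_, ?_, ?_, hc₂v, hc₁v, hc₀v, hc₀v', ?_, by omega⟩
  · rw [show (c₂ : K) = ι c₂ from rfl, hc₂, eC₂]
  · rw [show (c₁ : K) = ι c₁ from rfl, hc₁, eC₁]
  · rw [show (c₀ : K) = ι c₀ from rfl, hc₀, eC₀]
  · rw [ord_eq_natCast_iff_intValuation_eq, ← HeightOneSpectrum.valuation_of_algebraMap (K := K)]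
    change v.valuation K (ι D) = _
    rw [vD]
    congr 1; omega


/-! ### Eisenstein data, quadratic case (`θ = λe²`: Kodaira types `IV`, `II*`) -/

/-- **Eisenstein data for `θ = λe²`.**  As `exists_eisenstein_data_linear`, for
`(k₂, k₄, k₆) = (1, 2, 2)`, `c = 1` (type `IV`) or `(2, 4, 5)`, `c = 3` (type `II*`): with `λ` of
`ord_v λ = -c` the numbers `c₂ = -λ(b₂² - 16b₄)/16`, `c₁ = λ²(2b₄² - b₂b₆)/8`, `c₀ = -λ³b₆²/16`
lie in `𝓞 K`, the cubic is Eisenstein at `v`, and its discriminant has `ord_v = e + 2k₆ - 6c`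
(`1024·disc = λ⁶Δ(2b₆ - b₂b₄)²`, `ord_v(2b₆ - b₂b₄) = k₆`).  Silverman *ATAEC* pp. 368–371
(types `IV`, `II*`). [cite: SilvermanATAEC1994, proof of Thm. IV.11.1 for p = 3 (PDF pp. 368–371)] -/
theorem exists_eisenstein_data_quadratic (Y : WeierstrassCurve K) (v : HeightOneSpectrum (𝓞 K))
    (h2 : (2 : 𝓞 K) ∉ v.asIdeal) {c k₂ k₄ k₆ e : ℕ}
    (hk : (c = 1 ∧ k₂ = 1 ∧ k₄ = 2 ∧ k₆ = 2) ∨ (c = 3 ∧ k₂ = 2 ∧ k₄ = 4 ∧ k₆ = 5))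
    (hb₂ : v.valuation K Y.b₂ ≤ exp (-(k₂ : ℤ))) (hb₄ : v.valuation K Y.b₄ ≤ exp (-(k₄ : ℤ)))
    (hb₆ : v.valuation K Y.b₆ = exp (-(k₆ : ℤ))) (hΔ : v.valuation K Y.Δ = exp (-(e : ℤ))) :
    ∃ (lam : K) (c₂ c₁ c₀ : 𝓞 K) (n : ℕ), lam ≠ 0 ∧
      (c₂ : K) * 16 = -lam * (Y.b₂ ^ 2 - 16 * Y.b₄) ∧
      (c₁ : K) * 8 = lam ^ 2 * (2 * Y.b₄ ^ 2 - Y.b₂ * Y.b₆) ∧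
      (c₀ : K) * 16 = -lam ^ 3 * Y.b₆ ^ 2 ∧
      c₂ ∈ v.asIdeal ∧ c₁ ∈ v.asIdeal ∧ c₀ ∈ v.asIdeal ∧ c₀ ∉ v.asIdeal ^ 2 ∧
      ord v.asIdeal (c₂ ^ 2 * c₁ ^ 2 - 4 * c₁ ^ 3 - 4 * c₂ ^ 3 * c₀ - 27 * c₀ ^ 2 +
        18 * c₂ * c₁ * c₀) = n ∧ n + 6 * c = e + 2 * k₆ := by
  set ι := algebraMap (𝓞 K) K with hι
  have ιinj : Function.Injective ι := IsFractionRing.injective (𝓞 K) K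
  -- a common denominator `d` of `b₂, b₄, b₆` and the scaling factor `λ`
  obtain ⟨d, m₂, m₄, m₆, hd, hm₂, hm₄, hm₆⟩ := exists_common_denominator Y.b₂ Y.b₄ Y.b₆
  obtain ⟨lam, hlam0, hlamv, hlamq⟩ := exists_scaling v c hd
  -- valuations of numerals
  have hv2 : ∀ k : ℕ, v.valuation K ((2 : K) ^ k) = 1 := valuation_two_pow_eq_one v h2
  have hv2' : v.valuation K (2 : K) = 1 := by have h := hv2 1; norm_num at h; exact h
  have hv8 : v.valuation K (8 : K) = 1 := by have h := hv2 3; norm_num at h; exact h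
  have hv16 : v.valuation K (16 : K) = 1 := by have h := hv2 4; norm_num at h; exact h
  have hv1024 : v.valuation K (1024 : K) = 1 := by have h := hv2 10; norm_num at h; exact h
  have hq16 : ∀ q : HeightOneSpectrum (𝓞 K), q.valuation K (16 : K) ≤ 1 ∧
      q.valuation K (2 : K) ≤ 1 ∧ q.valuation K (16 : K) ^ 2 ≤ q.valuation K (8 : K) ∧
      q.valuation K (16 : K) ^ 3 ≤ q.valuation K (16 : K) := by
    intro q
    have h2 : q.valuation K (2 : K) ≤ 1 := by exact_mod_cast valuation_natCast_le_one q 2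
    have h16 : q.valuation K (16 : K) ≤ 1 := by exact_mod_cast valuation_natCast_le_one q 16
    have h32 : q.valuation K (32 : K) ≤ 1 := by exact_mod_cast valuation_natCast_le_one q 32
    have h256 : q.valuation K (256 : K) ≤ 1 := by exact_mod_cast valuation_natCast_le_one q 256
    refine ⟨h16, h2, ?_, ?_⟩
    · rw [← map_pow, show (16 : K) ^ 2 = 32 * 8 by norm_num, map_mul]
      exact mul_le_of_le_one_left' h32
    · rw [← map_pow, show (16 : K) ^ 3 = 256 * 16 by norm_num, map_mul]
      exact mul_le_of_le_one_left' h256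
  -- valuations of `d bⱼ` and of `λ` at `q ≠ v`
  have hdb : ∀ q : HeightOneSpectrum (𝓞 K), q.valuation K (ι d * Y.b₂) ≤ 1 ∧
      q.valuation K (ι d * Y.b₄) ≤ 1 ∧ q.valuation K (ι d * Y.b₆) ≤ 1 := fun q ↦
    ⟨hm₂ ▸ q.valuation_le_one _, hm₄ ▸ q.valuation_le_one _, hm₆ ▸ q.valuation_le_one _⟩
  have hdq : ∀ q : HeightOneSpectrum (𝓞 K), q.valuation K (ι d) ≤ 1 := fun q ↦ q.valuation_le_one _
  have hlamq' : ∀ q : HeightOneSpectrum (𝓞 K), q ≠ v →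
      q.valuation K lam ≤ q.valuation K (16 : K) * q.valuation K (ι d) ^ 2 := by
    intro q hq
    have := hlamq q hq
    rwa [map_mul, map_pow, map_ofNat, map_mul, map_pow] at this
  -- the integral combinations `d²(b₂² - 16b₄)`, `d⁴(2b₄² - b₂b₆)`, `d⁴ b₆²`
  have hP₂ : ∀ q : HeightOneSpectrum (𝓞 K),
      q.valuation K (ι d ^ 2 * (Y.b₂ ^ 2 - 16 * Y.b₄)) ≤ 1 := by
    intro q
    have e1 : ι d ^ 2 * (Y.b₂ ^ 2 - 16 * Y.b₄) = (ι d * Y.b₂) ^ 2 - 16 * ι d * (ι d * Y.b₄) := by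
      ring
    rw [e1]
    refine Valuation.map_sub_le _ ?_ ?_
    · rw [map_pow]; exact pow_le_one' (hdb q).1 2
    · rw [map_mul, map_mul]
      exact mul_le_one' (mul_le_one' (hq16 q).1 (hdq q)) (hdb q).2.1
  have hP₁ : ∀ q : HeightOneSpectrum (𝓞 K),
      q.valuation K (ι d ^ 4 * (2 * Y.b₄ ^ 2 - Y.b₂ * Y.b₆)) ≤ 1 := by
    intro q
    have e1 : ι d ^ 4 * (2 * Y.b₄ ^ 2 - Y.b₂ * Y.b₆) =
        2 * ι d ^ 2 * (ι d * Y.b₄) ^ 2 - ι d ^ 2 * (ι d * Y.b₂) * (ι d * Y.b₆) := by ring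
    rw [e1]
    refine Valuation.map_sub_le _ ?_ ?_
    · rw [map_mul, map_mul, map_pow, map_pow]
      exact mul_le_one' (mul_le_one' (hq16 q).2.1 (pow_le_one' (hdq q) 2)) (pow_le_one' (hdb q).2.1 2)
    · rw [map_mul, map_mul, map_pow]
      exact mul_le_one' (mul_le_one' (pow_le_one' (hdq q) 2) (hdb q).1) (hdb q).2.2
  have hP₀ : ∀ q : HeightOneSpectrum (𝓞 K), q.valuation K (ι d ^ 4 * Y.b₆ ^ 2) ≤ 1 := by
    intro q
    have e1 : ι d ^ 4 * Y.b₆ ^ 2 = ι d ^ 2 * (ι d * Y.b₆) ^ 2 := by ring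
    rw [e1, map_mul, map_pow, map_pow]
    exact mul_le_one' (pow_le_one' (hdq q) 2) (pow_le_one' (hdb q).2.2 2)
  -- the three coefficients as elements of `K`
  set C₂ : K := -lam * (Y.b₂ ^ 2 - 16 * Y.b₄) / 16 with hC₂
  set C₁ : K := lam ^ 2 * (2 * Y.b₄ ^ 2 - Y.b₂ * Y.b₆) / 8 with hC₁
  set C₀ : K := -lam ^ 3 * Y.b₆ ^ 2 / 16 with hC₀
  have h16K : (16 : K) ≠ 0 := by norm_num
  have h8K : (8 : K) ≠ 0 := by norm_num
  have eC₂ : C₂ * 16 = -lam * (Y.b₂ ^ 2 - 16 * Y.b₄) := by rw [hC₂]; field_simp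
  have eC₁ : C₁ * 8 = lam ^ 2 * (2 * Y.b₄ ^ 2 - Y.b₂ * Y.b₆) := by rw [hC₁]; field_simp
  have eC₀ : C₀ * 16 = -lam ^ 3 * Y.b₆ ^ 2 := by rw [hC₀]; field_simp
  -- the numerology of the two types
  have hkc : c + 1 ≤ 2 * k₂ ∧ c + 1 ≤ k₄ ∧ 2 * c + 1 ≤ 2 * k₄ ∧ 2 * c + 1 ≤ k₂ + k₆ ∧
      2 * k₆ = 3 * c + 1 ∧ k₆ < k₂ + k₄ := by
    rcases hk with ⟨h1, h2, h3, h4⟩ | ⟨h1, h2, h3, h4⟩ <;> omega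
  obtain ⟨hk₂, hk₄, hk₄', hk₂₆, hk₆, hklt⟩ := hkc
  have hexp : ∀ (k : ℕ) (b : ℤ), exp b ^ k = exp ((k : ℤ) * b) := fun k b ↦ by
    rw [← exp_nsmul]; simp
  -- their `v`-adic valuations
  have vP₂ : v.valuation K (Y.b₂ ^ 2 - 16 * Y.b₄) ≤ exp (-((c : ℤ) + 1)) := by
    refine Valuation.map_sub_le _ ?_ ?_
    · rw [map_pow]
      calc v.valuation K Y.b₂ ^ 2 ≤ exp (-(k₂ : ℤ)) ^ 2 := pow_le_pow_left' hb₂ 2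
        _ ≤ exp (-((c : ℤ) + 1)) := by rw [hexp, exp_le_exp]; push_cast; omega
    · rw [map_mul, hv16, one_mul]
      exact hb₄.trans (by rw [exp_le_exp]; omega)
  have vP₁ : v.valuation K (2 * Y.b₄ ^ 2 - Y.b₂ * Y.b₆) ≤ exp (-(2 * (c : ℤ) + 1)) := by
    refine Valuation.map_sub_le _ ?_ ?_
    · rw [map_mul, map_pow, hv2', one_mul]
      calc v.valuation K Y.b₄ ^ 2 ≤ exp (-(k₄ : ℤ)) ^ 2 := pow_le_pow_left' hb₄ 2
        _ ≤ exp (-(2 * (c : ℤ) + 1)) := by rw [hexp, exp_le_exp]; push_cast; omega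
    · rw [map_mul, hb₆]
      calc v.valuation K Y.b₂ * exp (-(k₆ : ℤ)) ≤ exp (-(k₂ : ℤ)) * exp (-(k₆ : ℤ)) :=
            mul_le_mul_left hb₂ _
        _ ≤ exp (-(2 * (c : ℤ) + 1)) := by rw [← exp_add, exp_le_exp]; omega
  have vC₂ : v.valuation K C₂ ≤ exp (-1 : ℤ) := by
    have h : v.valuation K C₂ * v.valuation K (16 : K) =
        v.valuation K lam * v.valuation K (Y.b₂ ^ 2 - 16 * Y.b₄) := by
      rw [← map_mul, ← map_mul, eC₂, neg_mul, Valuation.map_neg]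
    rw [hv16, mul_one, hlamv] at h
    rw [h]
    calc exp (c : ℤ) * v.valuation K (Y.b₂ ^ 2 - 16 * Y.b₄) ≤ exp (c : ℤ) * exp (-((c : ℤ) + 1)) :=
          mul_le_mul_right vP₂ _
      _ = exp (-1) := by rw [← exp_add]; congr 1; ring
  have vC₁ : v.valuation K C₁ ≤ exp (-1 : ℤ) := by
    have h : v.valuation K C₁ * v.valuation K (8 : K) =
        v.valuation K lam ^ 2 * v.valuation K (2 * Y.b₄ ^ 2 - Y.b₂ * Y.b₆) := by
      rw [← map_pow, ← map_mul, ← map_mul, eC₁]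
    rw [hv8, mul_one, hlamv, hexp] at h
    rw [h]
    calc exp ((2 : ℕ) * (c : ℤ)) * v.valuation K (2 * Y.b₄ ^ 2 - Y.b₂ * Y.b₆)
        ≤ exp ((2 : ℕ) * (c : ℤ)) * exp (-(2 * (c : ℤ) + 1)) := mul_le_mul_right vP₁ _
      _ = exp (-1) := by rw [← exp_add]; congr 1; push_cast; ring
  have vC₀ : v.valuation K C₀ = exp (-1 : ℤ) := by
    have h : v.valuation K C₀ * v.valuation K (16 : K) =
        v.valuation K lam ^ 3 * v.valuation K Y.b₆ ^ 2 := by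
      rw [← map_pow, ← map_pow, ← map_mul, ← map_mul, eC₀, neg_mul, Valuation.map_neg]
    rw [hv16, mul_one, hlamv, hexp, hb₆, hexp, ← exp_add] at h
    rw [h]; congr 1; push_cast; omega
  -- integrality
  have hle1 : exp (-1 : ℤ) ≤ (1 : ℤᵐ⁰) := by rw [← exp_zero, exp_le_exp]; norm_num
  obtain ⟨c₂, hc₂⟩ : ∃ y : 𝓞 K, ι y = C₂ := by
    refine exists_algebraMap_eq_of_valuation_le v h16K (vC₂.trans hle1) fun q hq ↦ ?_
    rw [eC₂, neg_mul, Valuation.map_neg, map_mul]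
    calc q.valuation K lam * q.valuation K (Y.b₂ ^ 2 - 16 * Y.b₄)
        ≤ (q.valuation K (16 : K) * q.valuation K (ι d) ^ 2) * q.valuation K (Y.b₂ ^ 2 - 16 * Y.b₄) :=
          mul_le_mul_left (hlamq' q hq) _
      _ = q.valuation K (16 : K) * q.valuation K (ι d ^ 2 * (Y.b₂ ^ 2 - 16 * Y.b₄)) := by
          rw [map_mul, map_pow, mul_assoc]
      _ ≤ q.valuation K (16 : K) * 1 := mul_le_mul_right (hP₂ q) _
      _ = q.valuation K (16 : K) := mul_one _
  obtain ⟨c₁, hc₁⟩ : ∃ y : 𝓞 K, ι y = C₁ := by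
    refine exists_algebraMap_eq_of_valuation_le v h8K (vC₁.trans hle1) fun q hq ↦ ?_
    rw [eC₁, map_mul, map_pow]
    calc q.valuation K lam ^ 2 * q.valuation K (2 * Y.b₄ ^ 2 - Y.b₂ * Y.b₆)
        ≤ (q.valuation K (16 : K) * q.valuation K (ι d) ^ 2) ^ 2 *
            q.valuation K (2 * Y.b₄ ^ 2 - Y.b₂ * Y.b₆) :=
          mul_le_mul_left (pow_le_pow_left' (hlamq' q hq) 2) _
      _ = q.valuation K (16 : K) ^ 2 * q.valuation K (ι d ^ 4 * (2 * Y.b₄ ^ 2 - Y.b₂ * Y.b₆)) := by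
          rw [map_mul, map_pow, mul_pow, ← pow_mul, mul_assoc]
      _ ≤ q.valuation K (16 : K) ^ 2 * 1 := mul_le_mul_right (hP₁ q) _
      _ ≤ q.valuation K (8 : K) := by rw [mul_one]; exact (hq16 q).2.2.1
  obtain ⟨c₀, hc₀⟩ : ∃ y : 𝓞 K, ι y = C₀ := by
    refine exists_algebraMap_eq_of_valuation_le v h16K (vC₀.le.trans hle1) fun q hq ↦ ?_
    rw [eC₀, neg_mul, Valuation.map_neg, map_mul, map_pow]
    calc q.valuation K lam ^ 3 * q.valuation K (Y.b₆ ^ 2)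
        ≤ (q.valuation K (16 : K) * q.valuation K (ι d) ^ 2) ^ 3 * q.valuation K (Y.b₆ ^ 2) :=
          mul_le_mul_left (pow_le_pow_left' (hlamq' q hq) 3) _
      _ = q.valuation K (16 : K) ^ 3 * q.valuation K (ι d) ^ 2 *
            q.valuation K (ι d ^ 4 * Y.b₆ ^ 2) := by
          rw [map_mul, map_pow (q.valuation K) (ι d) 4, mul_pow, ← pow_mul,
            show (2 * 3 : ℕ) = 2 + 4 from rfl, pow_add]
          simp only [mul_assoc]
      _ ≤ q.valuation K (16 : K) ^ 3 * 1 * 1 :=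
          mul_le_mul' (mul_le_mul_right (pow_le_one' (hdq q) 2) _) (hP₀ q)
      _ ≤ q.valuation K (16 : K) := by rw [mul_one, mul_one]; exact (hq16 q).2.2.2
  -- membership in `v`, `v²`
  have mem_of_le : ∀ {y : 𝓞 K}, v.valuation K (ι y) ≤ exp (-1 : ℤ) → y ∈ v.asIdeal := by
    intro y hy
    apply (v.valuation_lt_one_iff_mem (K := K) y).mp
    exact lt_of_le_of_lt hy (by rw [← exp_zero, exp_lt_exp]; norm_num)
  have hc₂v : c₂ ∈ v.asIdeal := mem_of_le (by rw [hc₂]; exact vC₂)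
  have hc₁v : c₁ ∈ v.asIdeal := mem_of_le (by rw [hc₁]; exact vC₁)
  have hc₀v : c₀ ∈ v.asIdeal := mem_of_le (by rw [hc₀]; exact vC₀.le)
  have hc₀v' : c₀ ∉ v.asIdeal ^ 2 := by
    intro h
    have := (v.intValuation_le_pow_iff_mem c₀ 2).mpr h
    rw [← HeightOneSpectrum.valuation_of_algebraMap (K := K)] at this
    change v.valuation K (ι c₀) ≤ _ at this
    rw [hc₀, vC₀, exp_le_exp] at this
    norm_num at this
  -- the discriminant: `1024 · disc = λ⁶ Δ (2b₆ - b₂b₄)²`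
  set D : 𝓞 K := c₂ ^ 2 * c₁ ^ 2 - 4 * c₁ ^ 3 - 4 * c₂ ^ 3 * c₀ - 27 * c₀ ^ 2 +
    18 * c₂ * c₁ * c₀ with hDdef
  have hDK : ι D * 1024 = lam ^ 6 * Y.Δ * (2 * Y.b₆ - Y.b₂ * Y.b₄) ^ 2 := by
    have hrel := Y.b_relation
    simp only [hDdef, map_add, map_sub, map_mul, map_pow, map_ofNat, hc₂, hc₁, hc₀, hC₂, hC₁, hC₀,
      WeierstrassCurve.Δ]
    linear_combination (lam ^ 6 * Y.b₂ ^ 2 * (2 * Y.b₆ - Y.b₂ * Y.b₄) ^ 2 / 4) * hrel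
  have vS : v.valuation K (2 * Y.b₆ - Y.b₂ * Y.b₄) = exp (-(k₆ : ℤ)) := by
    rw [sub_eq_add_neg]
    have hlt : v.valuation K (-(Y.b₂ * Y.b₄)) < v.valuation K (2 * Y.b₆) := by
      rw [Valuation.map_neg, map_mul, map_mul, hv2', one_mul, hb₆]
      calc v.valuation K Y.b₂ * v.valuation K Y.b₄ ≤ exp (-(k₂ : ℤ)) * exp (-(k₄ : ℤ)) :=
            mul_le_mul' hb₂ hb₄
        _ < exp (-(k₆ : ℤ)) := by rw [← exp_add, exp_lt_exp]; omega
    rw [Valuation.map_add_eq_of_lt_left _ hlt, map_mul, hv2', one_mul, hb₆]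
  have vD : v.valuation K (ι D) = exp (6 * (c : ℤ) - e - 2 * k₆) := by
    have h : v.valuation K (ι D) * v.valuation K (1024 : K) =
        v.valuation K lam ^ 6 * v.valuation K Y.Δ * v.valuation K (2 * Y.b₆ - Y.b₂ * Y.b₄) ^ 2 := by
      rw [← map_pow, ← map_pow, ← map_mul, ← map_mul, ← map_mul, hDK]
    rw [hv1024, mul_one, hlamv, hΔ, vS, hexp, hexp, ← exp_add, ← exp_add] at h
    rw [h]; congr 1; push_cast; ring
  have h6c : 6 * c ≤ e + 2 * k₆ := by
    have h := v.valuation_le_one (K := K) D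
    change v.valuation K (ι D) ≤ 1 at h
    rw [vD, ← exp_zero, exp_le_exp] at h
    omega
  refine ⟨lam, c₂, c₁, c₀, e + 2 * k₆ - 6 * c, hlam0, ?_, ?_, ?_, hc₂v, hc₁v, hc₀v, hc₀v', ?_,
    by omega⟩
  · rw [show (c₂ : K) = ι c₂ from rfl, hc₂, eC₂]
  · rw [show (c₁ : K) = ι c₁ from rfl, hc₁, eC₁]
  · rw [show (c₀ : K) = ι c₀ from rfl, hc₀, eC₀]
  · rw [ord_eq_natCast_iff_intValuation_eq, ← HeightOneSpectrum.valuation_of_algebraMap (K := K)]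
    change v.valuation K (ι D) = _
    rw [vD]
    congr 1; omega

end NumberField

end OggWild

end WeierstrassCurve

end
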